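import Mathlib.Analysis.SpecialFunctions.Complex.Log
import Mathlib.Analysis.SpecialFunctions.Trigonometric.Basic
import Mathlib.Algebra.Field.GeomSum
import Mathlib.Algebra.Polynomial.Eval.Degree
import Mathlib.Algebra.Polynomial.BigOperators
import HarnessLib

/-!
# `|aₙ| ≤ ‖Re P‖_∞`: the leading coefficient of a polynomial is bounded by the sup of its real part on the circle

Topic `Literature/Analysis/Complex`, namespace `Literature.Analysis.Complex.LeadingCoefficientRealPartBound`.

Source: T. Sheil-Small, *Complex Polynomials* (CUP 2002), §4.4.8 Problem 2 (p. 155) [SheilSmall2002]: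
«Let `P(z) = Σ₀ⁿ a_k zᵏ` be a polynomial of degree `n`. Show that `|aₙ| ≤ ‖Re P‖_∞` (4.191).»
(`‖Re P‖_∞ = max_{|z|=1} |Re P(z)|`, cf. (4.187); in the book this is the case `T ≡ 1` of the
convolution inequality (4.187).)

**Proof given here (alternation over `2n` equally spaced points).** Let `η = e^{iπ/n}` and `c` be any
point of the unit circle. For `0 ≤ k < n`, `Σ_{j<2n} (−1)ʲ η^{jk} = Σ_j (−ηᵏ)ʲ = 0` (a full geometric sum:
`(−ηᵏ)^{2n} = 1`, `−ηᵏ ≠ 1` because `cos(kπ/n) > −1`), while for `k = n`, `(−1)ʲη^{jn} = 1`. Hence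
`Σ_{j<2n} (−1)ʲ P(cηʲ) = 2n·aₙcⁿ` (`alternating_sum_eval`). Choosing `cⁿ = |aₙ|/aₙ` and taking real
parts, `2n|aₙ| = Σ_j (−1)ʲ Re P(cηʲ) ≤ 2n‖Re P‖_∞`. The hypothesis `n ≥ 1` («degree n») is needed:
`P ≡ i` has `|a₀| = 1`, `Re P ≡ 0` (`counterexample_degree_zero`); `P = zⁿ` gives equality (`sharp`).

## Main statements

* `alternating_sum_pow`, `alternating_sum_pow_self`, `alternating_sum_eval` — the discrete
  orthogonality over the points `cηʲ`, `j < 2n`;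
* **`norm_coeff_le_of_abs_re_le`** — (4.191): `deg P ≤ n`, `n ≥ 1`, `|Re P| ≤ M` on `|z| = 1` ⟹ `|aₙ| ≤ M`;
* `sqrt_sq_add_sq_le_of_abs_trigPoly_le` — the same statement read for a real trigonometric polynomial
  `t(θ) = Σ_{k≤n} (a_k cos kθ + b_k sin kθ) = Re P(e^{iθ})`, `P = Σ (a_k − i b_k)zᵏ`: `√(aₙ² + bₙ²) ≤ ‖t‖_∞`;
* `sharp`, `counterexample_degree_zero`.

## References

* [SheilSmall2002] T. Sheil-Small, *Complex Polynomials*, Cambridge Studies in Advanced Mathematics 75,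
  CUP 2002, §4.4.6 (4.187) and §4.4.8 Problem 2 (4.191) (pp. 154–155)
  (held: `book:sheil-smallnd-complex-polynomials`, p0145).
-/

noncomputable section

open Polynomial Complex Finset

namespace Literature.Analysis.Complex.LeadingCoefficientRealPartBound

/-! ## Discrete orthogonality over the `2n` points `c·ηʲ`, `η = e^{iπ/n}` -/

/-- `ηⁿ = −1` for `η = e^{iπ/n}`, `n ≠ 0`. [cite: SheilSmall2002, §4.4.8 Problem 2 (p. 155)] -/
theorem eta_pow_self {n : ℕ} (hn : n ≠ 0) : Complex.exp (Real.pi / n * I) ^ n = -1 := by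
  rw [← Complex.exp_nat_mul, show (n : ℂ) * (Real.pi / n * I) = Real.pi * I by field_simp,
    Complex.exp_pi_mul_I]

/-- `|η| = 1`. [cite: SheilSmall2002, §4.4.8 Problem 2 (p. 155)] -/
theorem norm_eta (n : ℕ) : ‖Complex.exp (Real.pi / n * I)‖ = 1 := by
  rw [show (Real.pi : ℂ) / n * I = ((Real.pi / n : ℝ) : ℂ) * I by push_cast; ring,
    Complex.norm_exp_ofReal_mul_I]

/-- For `k < n`, `−ηᵏ ≠ 1` (`Re ηᵏ = cos(kπ/n) > −1 = cos π`). [cite: SheilSmall2002, §4.4.8 Problem 2 (p. 155)] -/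
theorem neg_eta_pow_ne_one {n k : ℕ} (hk : k < n) : -(Complex.exp (Real.pi / n * I) ^ k) ≠ 1 := by
  intro h
  have hn : (0 : ℝ) < n := by exact_mod_cast (Nat.zero_le k).trans_lt hk
  have h' : Complex.exp (Real.pi / n * I) ^ k = -1 := by
    have := congrArg Neg.neg h; simpa using this
  have hre : (Complex.exp (Real.pi / n * I) ^ k).re = Real.cos (k * Real.pi / n) := by
    rw [← Complex.exp_nat_mul,
      show (k : ℂ) * (Real.pi / n * I) = ((k * Real.pi / n : ℝ) : ℂ) * I by push_cast; ring,
      Complex.exp_ofReal_mul_I_re]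
  have hlt : Real.cos Real.pi < Real.cos (k * Real.pi / n) := by
    apply Real.cos_lt_cos_of_nonneg_of_le_pi (by positivity) le_rfl
    rw [div_lt_iff₀ hn]
    have hk' : (k : ℝ) < n := by exact_mod_cast hk
    nlinarith [Real.pi_pos]
  rw [h', Real.cos_pi] at *
  simp at hre
  linarith

/-- **Discrete orthogonality, `k < n`:** `Σ_{j<2n} (−1)ʲ (ηʲ)ᵏ = 0`. [cite: SheilSmall2002, §4.4.8 Problem 2 (p. 155)] -/
theorem alternating_sum_pow {n k : ℕ} (hk : k < n) :
    ∑ j ∈ range (2 * n), (-1 : ℂ) ^ j * (Complex.exp (Real.pi / n * I) ^ j) ^ k = 0 := by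
  have hn : n ≠ 0 := by omega
  set η := Complex.exp (Real.pi / n * I) with hη
  have h1 : ∀ j : ℕ, (-1 : ℂ) ^ j * (η ^ j) ^ k = (-(η ^ k)) ^ j := fun j => by
    rw [neg_pow (η ^ k) j, ← pow_mul, ← pow_mul, mul_comm k j]
  simp_rw [h1]
  rw [geom_sum_eq (neg_eta_pow_ne_one hk)]
  have h2n : (-(η ^ k)) ^ (2 * n) = 1 := by
    rw [Even.neg_pow ⟨n, two_mul n⟩, ← pow_mul, mul_comm k, pow_mul, pow_mul', eta_pow_self hn]
    norm_num
  rw [h2n, sub_self, zero_div]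

/-- **Discrete orthogonality, `k = n`:** `Σ_{j<2n} (−1)ʲ (ηʲ)ⁿ = 2n`. [cite: SheilSmall2002, §4.4.8 Problem 2 (p. 155)] -/
theorem alternating_sum_pow_self {n : ℕ} (hn : n ≠ 0) :
    ∑ j ∈ range (2 * n), (-1 : ℂ) ^ j * (Complex.exp (Real.pi / n * I) ^ j) ^ n = 2 * n := by
  set η := Complex.exp (Real.pi / n * I) with hη
  have h1 : ∀ j : ℕ, (-1 : ℂ) ^ j * (η ^ j) ^ n = 1 := fun j => by
    rw [← pow_mul, mul_comm j n, pow_mul, eta_pow_self hn, ← mul_pow, neg_one_mul, neg_neg, one_pow]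
  simp_rw [h1]
  simp [mul_comm]

/-- **The alternating sum of `P` over the points `cηʲ`:** for `deg P ≤ n`, `n ≠ 0` and any `c`,
`Σ_{j<2n} (−1)ʲ P(cηʲ) = 2n·aₙcⁿ` — all lower coefficients drop out. [cite: SheilSmall2002, §4.4.8 Problem 2 (p. 155)] -/
theorem alternating_sum_eval {n : ℕ} (hn : n ≠ 0) {p : ℂ[X]} (hpn : p.natDegree ≤ n) (c : ℂ) :
    ∑ j ∈ range (2 * n), (-1 : ℂ) ^ j * p.eval (c * Complex.exp (Real.pi / n * I) ^ j) =
      2 * n * (p.coeff n * c ^ n) := by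
  set η := Complex.exp (Real.pi / n * I) with hη
  have hev : ∀ w : ℂ, p.eval w = ∑ k ∈ range (n + 1), p.coeff k * w ^ k := fun w =>
    eval_eq_sum_range' (Nat.lt_succ_of_le hpn) w
  simp_rw [hev, mul_sum, mul_pow]
  rw [sum_comm]
  have hk : ∀ k ∈ range (n + 1), ∑ j ∈ range (2 * n), (-1 : ℂ) ^ j * (p.coeff k * (c ^ k * (η ^ j) ^ k)) =
      p.coeff k * c ^ k * ∑ j ∈ range (2 * n), (-1 : ℂ) ^ j * (η ^ j) ^ k := by
    intro k _
    rw [mul_sum]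
    exact sum_congr rfl fun j _ => by ring
  rw [sum_congr rfl hk, sum_range_succ, alternating_sum_pow_self hn]
  have h0 : ∑ k ∈ range n, p.coeff k * c ^ k * ∑ j ∈ range (2 * n), (-1 : ℂ) ^ j * (η ^ j) ^ k = 0 :=
    sum_eq_zero fun k hk => by rw [alternating_sum_pow (mem_range.1 hk), mul_zero]
  rw [h0, zero_add]
  ring

/-! ## (4.191) -/

/-- **Sheil-Small §4.4.8 Problem 2, (4.191): `|aₙ| ≤ ‖Re P‖_∞`.** If `P ∈ ℂ[z]` has degree at most
`n ≥ 1` and `|Re P(w)| ≤ M` for all `|w| = 1`, then its `n`-th coefficient satisfies `|aₙ| ≤ M`.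
(Alternation: with `cⁿ = |aₙ|/aₙ`, `2n|aₙ| = Σ_{j<2n} (−1)ʲ Re P(cηʲ) ≤ 2nM`.)
[cite: SheilSmall2002, §4.4.8 Problem 2 (4.191) (p. 155)] -/
theorem norm_coeff_le_of_abs_re_le {n : ℕ} (hn : 0 < n) {p : ℂ[X]} (hpn : p.natDegree ≤ n) {M : ℝ}
    (hM : ∀ w : ℂ, ‖w‖ = 1 → |(p.eval w).re| ≤ M) : ‖p.coeff n‖ ≤ M := by
  have hM0 : 0 ≤ M := (abs_nonneg _).trans (hM 1 (by simp))
  by_cases ha : p.coeff n = 0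
  · rw [ha, norm_zero]; exact hM0
  -- a unimodular `v` with `aₙ v = |aₙ|`, and an `n`-th root `c` of `v`
  set a : ℂ := p.coeff n with hadef
  set v : ℂ := (‖a‖ : ℂ) / a with hv
  have hv1 : ‖v‖ = 1 := by
    rw [hv, norm_div, Complex.norm_real, Real.norm_eq_abs, abs_norm, div_self (norm_ne_zero_iff.2 ha)]
  have hav : a * v = ‖a‖ := by rw [hv]; field_simp
  set c : ℂ := Complex.exp ((Complex.arg v / n : ℝ) * I) with hc
  have hc1 : ‖c‖ = 1 := by rw [hc, Complex.norm_exp_ofReal_mul_I]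
  have hn0 : (n : ℂ) ≠ 0 := Nat.cast_ne_zero.2 hn.ne'
  have hcn : c ^ n = v := by
    rw [hc, ← Complex.exp_nat_mul,
      show (n : ℂ) * (((Complex.arg v / n : ℝ) : ℂ) * I) = Complex.arg v * I by
        push_cast; field_simp]
    have h := Complex.norm_mul_exp_arg_mul_I v
    rw [hv1] at h
    simpa using h
  set η := Complex.exp (Real.pi / n * I) with hη
  have hω : ∀ j : ℕ, ‖c * η ^ j‖ = 1 := fun j => by
    rw [norm_mul, norm_pow, hc1, hη, norm_eta, one_pow, one_mul]
  -- the alternating sum equals `2n|aₙ|`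
  have hS := alternating_sum_eval hn.ne' hpn c
  rw [hcn, hav] at hS
  have hre : (∑ j ∈ range (2 * n), (-1 : ℂ) ^ j * p.eval (c * η ^ j)).re = 2 * n * ‖a‖ := by
    rw [hS]
    simp
  -- and its real part is at most `2nM`
  have hle : (∑ j ∈ range (2 * n), (-1 : ℂ) ^ j * p.eval (c * η ^ j)).re ≤ 2 * n * M := by
    rw [Complex.re_sum]
    calc ∑ j ∈ range (2 * n), ((-1 : ℂ) ^ j * p.eval (c * η ^ j)).re
        ≤ ∑ j ∈ range (2 * n), |(p.eval (c * η ^ j)).re| := by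
          refine sum_le_sum fun j _ => ?_
          rcases neg_one_pow_eq_or ℂ j with h | h <;> rw [h]
          · rw [one_mul]; exact le_abs_self _
          · rw [neg_one_mul, Complex.neg_re]; exact neg_le_abs _
      _ ≤ ∑ j ∈ range (2 * n), M := sum_le_sum fun j _ => hM _ (hω j)
      _ = 2 * n * M := by rw [sum_const, card_range, nsmul_eq_mul]; push_cast; ring
  rw [hre] at hle
  have hn' : (0 : ℝ) < 2 * n := by positivity
  exact le_of_mul_le_mul_left hle hn'

/-! ## The real form, sharpness, and the degree-zero exception -/

/-- The real part of `(a − ib)·w^k` at `w = e^{iθ}` is `a cos kθ + b sin kθ`. [folklore] -/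
private theorem re_coeff_mul_exp_pow (a b θ : ℝ) (k : ℕ) :
    (((a : ℂ) - b * I) * Complex.exp (θ * I) ^ k).re = a * Real.cos (k * θ) + b * Real.sin (k * θ) := by
  rw [← Complex.exp_nat_mul, show (k : ℂ) * (θ * I) = ((k * θ : ℝ) : ℂ) * I by push_cast; ring,
    Complex.exp_mul_I]
  simp only [Complex.mul_re, Complex.sub_re, Complex.ofReal_re, Complex.mul_im, Complex.ofReal_im,
    Complex.I_re, Complex.I_im, Complex.sub_im, Complex.add_re, Complex.add_im,
    ← Complex.ofReal_cos, ← Complex.ofReal_sin]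
  ring

/-- **(4.191) for real trigonometric polynomials.** If
`t(θ) = Σ_{k≤n} (a_k cos kθ + b_k sin kθ)` (`n ≥ 1`, real coefficients) satisfies `|t(θ)| ≤ M` for all
real `θ`, then `√(aₙ² + bₙ²) ≤ M`: indeed `t(θ) = Re P(e^{iθ})` for `P = Σ (a_k − i b_k) zᵏ`, whose `n`-th
coefficient has modulus `√(aₙ² + bₙ²)`. [cite: SheilSmall2002, §4.4.8 Problem 2 (4.191) (p. 155)] -/
theorem sqrt_sq_add_sq_le_of_abs_trigPoly_le {n : ℕ} (hn : 0 < n) (a b : ℕ → ℝ) {M : ℝ}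
    (hM : ∀ θ : ℝ, |∑ k ∈ range (n + 1), (a k * Real.cos (k * θ) + b k * Real.sin (k * θ))| ≤ M) :
    Real.sqrt (a n ^ 2 + b n ^ 2) ≤ M := by
  set p : ℂ[X] := ∑ k ∈ range (n + 1), C ((a k : ℂ) - b k * I) * X ^ k with hp
  have hpn : p.natDegree ≤ n := by
    refine Polynomial.natDegree_sum_le_of_forall_le _ _ fun k hk => ?_
    refine (natDegree_C_mul_le _ _).trans ?_
    rw [natDegree_X_pow]
    exact Nat.lt_succ_iff.1 (mem_range.1 hk)
  have hcoeff : p.coeff n = (a n : ℂ) - b n * I := by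
    rw [hp, finsetSum_coeff]
    simp only [coeff_C_mul, coeff_X_pow, mul_ite, mul_one, mul_zero]
    rw [sum_ite_eq (range (n + 1)) n, if_pos (self_mem_range_succ n)]
  have hnorm : ‖p.coeff n‖ = Real.sqrt (a n ^ 2 + b n ^ 2) := by
    rw [hcoeff, Complex.norm_def, Complex.normSq_apply]
    congr 1
    simp
    ring
  rw [← hnorm]
  refine norm_coeff_le_of_abs_re_le hn hpn fun w hw => ?_
  -- `w = e^{iθ}` with `θ = arg w`
  obtain ⟨θ, rfl⟩ : ∃ θ : ℝ, w = Complex.exp (θ * I) := by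
    refine ⟨Complex.arg w, ?_⟩
    have h := Complex.norm_mul_exp_arg_mul_I w
    rw [hw] at h
    simpa using h.symm
  have hre : (p.eval (Complex.exp (θ * I))).re =
      ∑ k ∈ range (n + 1), (a k * Real.cos (k * θ) + b k * Real.sin (k * θ)) := by
    rw [hp, eval_finsetSum, Complex.re_sum]
    refine sum_congr rfl fun k _ => ?_
    rw [eval_mul, eval_C, eval_pow, eval_X, ← re_coeff_mul_exp_pow]
  rw [hre]
  exact hM _

/-- **Sharpness of (4.191):** for `P = zⁿ`, `|aₙ| = 1` and `|Re P(w)| = |Re wⁿ| ≤ 1` on `|w| = 1`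
(with equality at `w = 1`). [cite: SheilSmall2002, §4.4.8 Problem 2 (4.191) (p. 155)] -/
theorem sharp (n : ℕ) :
    ‖(X ^ n : ℂ[X]).coeff n‖ = 1 ∧ (∀ w : ℂ, ‖w‖ = 1 → |((X ^ n : ℂ[X]).eval w).re| ≤ 1) ∧
      |((X ^ n : ℂ[X]).eval 1).re| = 1 := by
  refine ⟨by simp, fun w hw => ?_, by simp⟩
  rw [eval_pow, eval_X]
  calc |(w ^ n).re| ≤ ‖w ^ n‖ := Complex.abs_re_le_norm _
    _ = 1 := by rw [norm_pow, hw, one_pow]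

/-- **`n ≥ 1` is needed** («of degree n»): the constant `P ≡ i` has `|a₀| = 1` but `Re P ≡ 0`.
[cite: SheilSmall2002, §4.4.8 Problem 2 (4.191) (p. 155)] -/
theorem counterexample_degree_zero :
    ‖(C I : ℂ[X]).coeff 0‖ = 1 ∧ (∀ w : ℂ, |((C I : ℂ[X]).eval w).re| ≤ 0) ∧ ¬ (‖(C I : ℂ[X]).coeff 0‖ ≤ 0) := by
  refine ⟨by simp, fun w => by simp, by simp⟩

end Literature.Analysis.Complex.LeadingCoefficientRealPartBound

end
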